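import Mathlib
import HarnessLib
import Summits.Ventures.LatticeQCDFlow.Exactness.SphereStein
import Summits.Ventures.LatticeQCDFlow.Exactness.SphereTransitive
import Summits.Ventures.LatticeQCDFlow.Exactness.StdGaussianRadial

/-!
# The `SO(d)`-orbit law of a unit vector is the uniform probability on the sphere (the CP(N−1) sphere dictionary)

HONEST FRAMING: exact (Metropolis-corrected) sampling algorithms for lattice gauge theory;
figures of merit are autocorrelation/cost numbers at stated couplings and volumes; no
continuum-physics claim.

Venture `LatticeQCDFlow` (cell pub-lqcd), topic `Exactness`, FANOUT row 9 (eng-latcore, the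
engine `latflow.core`).  NEW WORK of the cell, composing row 9's `SphereTransitive.lean` (two
Householder reflections: `SO(d)` is transitive on the unit sphere, `d ≥ 2`), `StdGaussianRadial.lean`
/ `RadialPolar.lean` (`uniformSphere`, the direction of a standard Gaussian vector is uniform) and
gen-7's `CompactHaar.lean` (Haar on a compact group is right invariant), over Mathlib
(`stdGaussian_map`, Tonelli).  Nothing is cited as a fact.  Printed counterpart, NAMED ONLY: the
uniqueness of the rotation-invariant probability on `S^{d−1}` (e.g. Folland, *Real Analysis*,
Thm 2.49 ff.; Mattila, *Geometry of Sets and Measures* §3).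

Gen-8's `SphereStein.lean` proved the CP(N−1) site Stein identity for the ORBIT LAW `x = O e`,
`O ∼ Haar(SO(d))`, and left "the identification of the `SO(d)`-orbit law with the surface measure"
as the untyped dictionary.  This file types it: the orbit law IS `uniformSphere volume`.

## What is proved (`m` finite, `E = EuclideanSpace ℝ m`, `S = sphere (0 : E) 1`, `SO = Matrix.specialOrthogonalGroup m ℝ`)

* `rotIso A hA : E ≃ₗᵢ[ℝ] E` — an orthogonal matrix acting on `E` (`x ↦ A x`); `actS A hA : S → S`
  its restriction to the sphere; `dirSphere_rotIso` — equivariance of the direction map off `0`;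
  `actSO O` for `O ∈ SO`, jointly continuous (`continuous_actSO`).
* `stdGaussian_singleton_zero'` — the origin is Gaussian-null (any nonempty index type);
  **`uniformSphere_map_actS`** — the uniform probability on the sphere is invariant under every
  orthogonal matrix (through the Gaussian: `uniformSphere = (stdGaussian E).map dirSphere`).
* `orbitLaw s = (Haar SO).map (O ↦ O s)`; `orbitLaw_actSO` — right invariance of Haar makes it
  constant along orbits; `exists_actSO_eq` — transitivity on `S` (`card m ≥ 2`).
* **`orbitLaw_eq_uniformSphere`** — for `card m ≥ 2` and every `e ∈ S`:
  `(Haar SO).map (O ↦ O e) = uniformSphere volume` (averaging: `ν(A) = ∫ ν(O⁻¹A) dHaar(O) =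
  ∫∫ 1_A(O s) dν dHaar = ∫ orbitLaw_s(A) dν(s) = orbitLaw_e(A)`).
* **`map_mulVec_haar_eq_uniformSphere`** — the dictionary in `SphereStein.lean`'s own vocabulary
  (vectors `m → ℝ`, `e ⬝ᵥ e = 1`): `(Haar SO).map (O ↦ O *ᵥ e) = (uniformSphere volume).map (↑)`, so
  `sphere_stein_linear` is an identity for the uniform sphere law weighted by `e^{κ F·x}` — the
  CP(N−1) site law of the engine (`cpn_2d`) up to the realification `ℂ^N ≅ ℝ^{2N}`.

NOT CLAIMED: the realification bookkeeping `ℂ^N ≅ ℝ^{2N}` of the CP(N−1) site (coordinates only);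
`d = 1`.
-/

namespace Summit.Ventures.LatticeQCDFlow.Exactness

open MeasureTheory Measure Metric Set ProbabilityTheory WithLp Matrix
open scoped ENNReal

section Orbit

variable {m : Type*} [Fintype m] [DecidableEq m]

/-! ## §1 Orthogonal matrices act on `E` and on its unit sphere -/

omit [DecidableEq m] in
/-- The squared Euclidean norm of `toLp 2 y` is `y ⬝ᵥ y`. -/
theorem norm_toLp_sq (y : m → ℝ) : ‖(toLp 2 y : (EuclideanSpace ℝ m))‖ ^ 2 = y ⬝ᵥ y := by
  rw [EuclideanSpace.real_norm_sq_eq, dotProduct]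
  simp [sq]

/-- An orthogonal matrix preserves `y ⬝ᵥ y`. -/
theorem dotProduct_mulVec_self_of_mem {A : Matrix m m ℝ} (hA : A ∈ Matrix.orthogonalGroup m ℝ)
    (y : m → ℝ) : (A *ᵥ y) ⬝ᵥ (A *ᵥ y) = y ⬝ᵥ y := by
  rw [dotProduct_mulVec, ← mulVec_transpose, mulVec_mulVec, (Matrix.mem_orthogonalGroup_iff' m ℝ).1 hA,
    one_mulVec]

/-- **An orthogonal matrix as a linear isometry of `EuclideanSpace ℝ m`.** -/
noncomputable def rotIso (A : Matrix m m ℝ) (hA : A ∈ Matrix.orthogonalGroup m ℝ) : (EuclideanSpace ℝ m) ≃ₗᵢ[ℝ] (EuclideanSpace ℝ m) :=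
  (LinearIsometry.mk
    ({ toFun := fun x : (EuclideanSpace ℝ m) => (toLp 2 (A *ᵥ ofLp x) : (EuclideanSpace ℝ m))
       map_add' := fun x y => by
         change toLp 2 (A *ᵥ (ofLp x + ofLp y)) = _
         rw [mulVec_add]; rfl
       map_smul' := fun c x => by
         change toLp 2 (A *ᵥ (c • ofLp x)) = _
         rw [mulVec_smul]; rfl } : (EuclideanSpace ℝ m) →ₗ[ℝ] (EuclideanSpace ℝ m))
    (fun x => by
      have h : ‖(toLp 2 (A *ᵥ ofLp x) : (EuclideanSpace ℝ m))‖ ^ 2 = ‖x‖ ^ 2 := by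
        rw [norm_toLp_sq, dotProduct_mulVec_self_of_mem hA, ← norm_toLp_sq]
      exact (pow_left_inj₀ (norm_nonneg _) (norm_nonneg _) two_ne_zero).1 h)).toLinearIsometryEquiv rfl

/-- Pointwise formula. -/
theorem rotIso_apply {A : Matrix m m ℝ} (hA : A ∈ Matrix.orthogonalGroup m ℝ) (x : (EuclideanSpace ℝ m)) :
    rotIso A hA x = toLp 2 (A *ᵥ ofLp x) := by
  rw [rotIso, LinearIsometry.coe_toLinearIsometryEquiv]
  rfl

/-- The action on the unit sphere. -/
noncomputable def actS (A : Matrix m m ℝ) (hA : A ∈ Matrix.orthogonalGroup m ℝ) (s : sphere (0 : (EuclideanSpace ℝ m)) 1) :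
    sphere (0 : (EuclideanSpace ℝ m)) 1 :=
  ⟨rotIso A hA s, by rw [mem_sphere_zero_iff_norm, LinearIsometryEquiv.norm_map, norm_eq_of_mem_sphere s]⟩

/-- Coordinates of the action on the sphere. -/
@[simp] theorem coe_actS {A : Matrix m m ℝ} (hA : A ∈ Matrix.orthogonalGroup m ℝ) (s : sphere (0 : (EuclideanSpace ℝ m)) 1) :
    (actS A hA s : (EuclideanSpace ℝ m)) = toLp 2 (A *ᵥ ofLp (s : (EuclideanSpace ℝ m))) := rotIso_apply hA s

/-! ## §2 The orbit law under Haar on `SO(d)` -/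

/-- A special orthogonal matrix is orthogonal. -/
theorem mem_orthogonalGroup_of_SO (O : Matrix.specialOrthogonalGroup m ℝ) :
    (O : Matrix m m ℝ) ∈ Matrix.orthogonalGroup m ℝ :=
  (Matrix.mem_specialOrthogonalGroup_iff.1 O.2).1

/-- The action of `O ∈ SO(d)` on the unit sphere. -/
noncomputable def actSO (O : Matrix.specialOrthogonalGroup m ℝ) (s : sphere (0 : (EuclideanSpace ℝ m)) 1) : sphere (0 : (EuclideanSpace ℝ m)) 1 :=
  actS (O : Matrix m m ℝ) (mem_orthogonalGroup_of_SO O) s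

/-- Coordinates of the `SO(d)` action. -/
@[simp] theorem coe_actSO (O : Matrix.specialOrthogonalGroup m ℝ) (s : sphere (0 : (EuclideanSpace ℝ m)) 1) :
    (actSO O s : (EuclideanSpace ℝ m)) = toLp 2 ((O : Matrix m m ℝ) *ᵥ ofLp (s : (EuclideanSpace ℝ m))) := coe_actS _ s

/-- The action is a group action: `(O O') s = O (O' s)`. -/
theorem actSO_mul (O O' : Matrix.specialOrthogonalGroup m ℝ) (s : sphere (0 : (EuclideanSpace ℝ m)) 1) :
    actSO (O * O') s = actSO O (actSO O' s) := by
  apply Subtype.ext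
  rw [coe_actSO, coe_actSO, coe_actSO, Submonoid.coe_mul, ← mulVec_mulVec, ofLp_toLp]

/-- The action is jointly continuous. -/
theorem continuous_actSO : Continuous fun p : Matrix.specialOrthogonalGroup m ℝ × sphere (0 : (EuclideanSpace ℝ m)) 1 => actSO p.1 p.2 := by
  have h : Continuous fun p : Matrix.specialOrthogonalGroup m ℝ × sphere (0 : (EuclideanSpace ℝ m)) 1 =>
      (toLp 2 ((p.1 : Matrix m m ℝ) *ᵥ ofLp (p.2 : (EuclideanSpace ℝ m))) : (EuclideanSpace ℝ m)) :=
    (PiLp.continuous_toLp 2 _).comp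
      ((continuous_subtype_val.comp continuous_fst).matrix_mulVec
        ((PiLp.continuous_ofLp 2 _).comp (continuous_subtype_val.comp continuous_snd)))
  rw [Topology.IsInducing.subtypeVal.continuous_iff]
  have heq : ((↑) : sphere (0 : (EuclideanSpace ℝ m)) 1 → (EuclideanSpace ℝ m)) ∘ (fun p : Matrix.specialOrthogonalGroup m ℝ × sphere (0 : (EuclideanSpace ℝ m)) 1 =>
      actSO p.1 p.2) = fun p => (toLp 2 ((p.1 : Matrix m m ℝ) *ᵥ ofLp (p.2 : (EuclideanSpace ℝ m))) : (EuclideanSpace ℝ m)) := by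
    funext p
    exact coe_actSO p.1 p.2
  rw [heq]
  exact h

/-- For fixed `s`, `O ↦ O s` is measurable. -/
theorem measurable_actSO_left (s : sphere (0 : (EuclideanSpace ℝ m)) 1) :
    Measurable fun O : Matrix.specialOrthogonalGroup m ℝ => actSO O s :=
  (continuous_actSO.comp (Continuous.prodMk_left s)).measurable

/-- For fixed `O`, `s ↦ O s` is measurable. -/
theorem measurable_actSO_right (O : Matrix.specialOrthogonalGroup m ℝ) :
    Measurable fun s : sphere (0 : (EuclideanSpace ℝ m)) 1 => actSO O s :=
  (continuous_actSO.comp (Continuous.prodMk_right O)).measurable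

/-- **The orbit law** of `s` under the Haar probability of `SO(d)`: the law of `O s`. -/
noncomputable def orbitLaw (s : sphere (0 : (EuclideanSpace ℝ m)) 1) : Measure (sphere (0 : (EuclideanSpace ℝ m)) 1) :=
  (Literature.MathematicalPhysics.QuantumFieldTheory.haarProbability (Matrix.specialOrthogonalGroup m ℝ)).map fun O => actSO O s

/-- The orbit law is a probability measure. -/
instance isProbabilityMeasure_orbitLaw (s : sphere (0 : (EuclideanSpace ℝ m)) 1) : IsProbabilityMeasure (orbitLaw s) :=
  Measure.isProbabilityMeasure_map (measurable_actSO_left s).aemeasurable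

/-- **Right invariance of Haar makes the orbit law constant along orbits**: `orbitLaw (O₀ e) = orbitLaw e`. -/
theorem orbitLaw_actSO (O₀ : Matrix.specialOrthogonalGroup m ℝ) (e : sphere (0 : (EuclideanSpace ℝ m)) 1) :
    orbitLaw (actSO O₀ e) = orbitLaw e := by
  have h : (fun O : Matrix.specialOrthogonalGroup m ℝ => actSO O (actSO O₀ e)) =
      (fun O => actSO O e) ∘ (fun O => O * O₀) := by
    funext O
    exact (actSO_mul O O₀ e).symm
  rw [orbitLaw, orbitLaw, h, ← Measure.map_map (measurable_actSO_left e) (measurable_mul_const O₀),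
    map_mul_right_eq_self]

/-- **Transitivity on the sphere** (`card m ≥ 2`): every point is `O e` for some `O ∈ SO(d)`. -/
theorem exists_actSO_eq (h2 : 2 ≤ Fintype.card m) (e s : sphere (0 : (EuclideanSpace ℝ m)) 1) :
    ∃ O : Matrix.specialOrthogonalGroup m ℝ, actSO O e = s := by
  have hunit : ∀ u : sphere (0 : (EuclideanSpace ℝ m)) 1, ofLp (u : (EuclideanSpace ℝ m)) ⬝ᵥ ofLp (u : (EuclideanSpace ℝ m)) = 1 := fun u => by
    rw [← norm_toLp_sq, toLp_ofLp, norm_eq_of_mem_sphere u, one_pow]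
  obtain ⟨O, hO, hOe⟩ := exists_specialOrthogonal_mulVec_eq h2 (hunit e) (hunit s)
  refine ⟨⟨O, hO⟩, Subtype.ext ?_⟩
  rw [coe_actSO]
  change toLp 2 (O *ᵥ ofLp (e : (EuclideanSpace ℝ m))) = (s : (EuclideanSpace ℝ m))
  rw [hOe, toLp_ofLp]

variable [Nonempty m]

/-- **Equivariance of the direction map** off the origin: `dir(A x) = A · dir(x)`. -/
theorem dirSphere_rotIso {A : Matrix m m ℝ} (hA : A ∈ Matrix.orthogonalGroup m ℝ) {x : (EuclideanSpace ℝ m)} (hx : x ≠ 0) :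
    dirSphere (rotIso A hA x) = actS A hA (dirSphere x) := by
  have hAx : rotIso A hA x ≠ 0 := fun h => hx ((rotIso A hA).map_eq_zero_iff.1 h)
  apply Subtype.ext
  rw [dirSphere_coe hAx, LinearIsometryEquiv.norm_map, coe_actS, dirSphere_coe hx, ← rotIso_apply hA,
    LinearIsometryEquiv.map_smul]

omit [DecidableEq m] in
/-- The origin is null for the standard Gaussian (any nonempty finite index type). -/
theorem stdGaussian_singleton_zero' : stdGaussian (EuclideanSpace ℝ m) {(0 : (EuclideanSpace ℝ m))} = 0 := by
  haveI : NullSingletonClass (gaussianReal 0 1) := nullSingletonClass_gaussianReal one_ne_zero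
  obtain ⟨i⟩ := (inferInstance : Nonempty m)
  rw [← map_pi_eq_stdGaussian, Measure.map_apply (measurable_toLp 2 _) (measurableSet_singleton _)]
  refine measure_mono_null (fun f hf => ?_) (Measure.pi_hyperplane (fun _ : m => gaussianReal 0 1) i 0)
  have h0 : toLp 2 f = (0 : (EuclideanSpace ℝ m)) := hf
  have : f = 0 := by
    have := congrArg ofLp h0
    simpa using this
  simp [this]

/-- **The uniform probability on the sphere is invariant under every orthogonal matrix.** -/
theorem uniformSphere_map_actS {A : Matrix m m ℝ} (hA : A ∈ Matrix.orthogonalGroup m ℝ) :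
    (uniformSphere (volume : Measure (EuclideanSpace ℝ m))).map (actS A hA) = uniformSphere (volume : Measure (EuclideanSpace ℝ m)) := by
  have hact : Measurable (actS A hA) :=
    ((rotIso A hA).continuous.comp continuous_subtype_val).measurable.subtype_mk
  rw [← stdGaussian_map_dirSphere m, Measure.map_map hact measurable_dirSphere]
  have hae : actS A hA ∘ dirSphere =ᵐ[stdGaussian (EuclideanSpace ℝ m)] dirSphere ∘ rotIso A hA := by
    filter_upwards [compl_mem_ae_iff.2 (stdGaussian_singleton_zero' (m := m))] with x hx
    exact (dirSphere_rotIso hA hx).symm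
  rw [Measure.map_congr hae, ← Measure.map_map measurable_dirSphere (rotIso A hA).continuous.measurable,
    stdGaussian_map (rotIso A hA)]

/-! ## §3 The orbit law is the uniform probability on the sphere -/

/-- **The `SO(d)`-orbit law of a unit vector is the uniform probability on the sphere** (`card m ≥ 2`). -/
theorem orbitLaw_eq_uniformSphere (h2 : 2 ≤ Fintype.card m) (e : sphere (0 : (EuclideanSpace ℝ m)) 1) :
    orbitLaw e = uniformSphere (volume : Measure (EuclideanSpace ℝ m)) := by
  set ν := uniformSphere (volume : Measure (EuclideanSpace ℝ m)) with hν
  ext A hA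
  -- the averaging argument
  have hF : Measurable fun p : Matrix.specialOrthogonalGroup m ℝ × sphere (0 : (EuclideanSpace ℝ m)) 1 =>
      A.indicator (1 : sphere (0 : (EuclideanSpace ℝ m)) 1 → ℝ≥0∞) (actSO p.1 p.2) :=
    (measurable_one.indicator hA).comp continuous_actSO.measurable
  have hinner : ∀ s : sphere (0 : (EuclideanSpace ℝ m)) 1,
      ∫⁻ O, A.indicator (1 : sphere (0 : (EuclideanSpace ℝ m)) 1 → ℝ≥0∞) (actSO O s) ∂(Literature.MathematicalPhysics.QuantumFieldTheory.haarProbability (Matrix.specialOrthogonalGroup m ℝ)) = orbitLaw e A := fun s => by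
    obtain ⟨O₀, rfl⟩ := exists_actSO_eq h2 e s
    rw [← orbitLaw_actSO O₀ e, orbitLaw, Measure.map_apply (measurable_actSO_left _) hA,
      ← lintegral_indicator_one ((measurable_actSO_left _) hA)]
    rfl
  have houter : ∀ O : Matrix.specialOrthogonalGroup m ℝ,
      ∫⁻ s, A.indicator (1 : sphere (0 : (EuclideanSpace ℝ m)) 1 → ℝ≥0∞) (actSO O s) ∂ν = ν A := fun O => by
    change ∫⁻ s, ((fun s => actSO O s) ⁻¹' A).indicator 1 s ∂ν = ν A
    rw [lintegral_indicator_one ((measurable_actSO_right O) hA), ← Measure.map_apply (measurable_actSO_right O) hA]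
    change ((uniformSphere (volume : Measure (EuclideanSpace ℝ m))).map (actS (O : Matrix m m ℝ) (mem_orthogonalGroup_of_SO O))) A = _
    rw [uniformSphere_map_actS]
  symm
  calc ν A = ∫⁻ _O, ν A ∂(Literature.MathematicalPhysics.QuantumFieldTheory.haarProbability (Matrix.specialOrthogonalGroup m ℝ)) := by rw [lintegral_const, measure_univ, mul_one]
    _ = ∫⁻ O, ∫⁻ s, A.indicator (1 : sphere (0 : (EuclideanSpace ℝ m)) 1 → ℝ≥0∞) (actSO O s) ∂ν ∂(Literature.MathematicalPhysics.QuantumFieldTheory.haarProbability (Matrix.specialOrthogonalGroup m ℝ)) := by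
        simp_rw [houter]
    _ = ∫⁻ s, ∫⁻ O, A.indicator (1 : sphere (0 : (EuclideanSpace ℝ m)) 1 → ℝ≥0∞) (actSO O s) ∂(Literature.MathematicalPhysics.QuantumFieldTheory.haarProbability (Matrix.specialOrthogonalGroup m ℝ)) ∂ν :=
        lintegral_lintegral_swap hF.aemeasurable
    _ = ∫⁻ _s, orbitLaw e A ∂ν := by simp_rw [hinner]
    _ = orbitLaw e A := by rw [lintegral_const, measure_univ, mul_one]

/-- **The sphere dictionary for `SphereStein.lean`**: for a unit vector `e : m → ℝ` (`e ⬝ᵥ e = 1`) the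
law of `O *ᵥ e` under Haar on `SO(d)` (`d = card m ≥ 2`) is the uniform probability on the unit
sphere of `EuclideanSpace ℝ m`, read in coordinates. -/
theorem map_mulVec_haar_eq_uniformSphere (h2 : 2 ≤ Fintype.card m) {e : m → ℝ} (he : e ⬝ᵥ e = 1) :
    (Literature.MathematicalPhysics.QuantumFieldTheory.haarProbability (Matrix.specialOrthogonalGroup m ℝ)).map (fun O : Matrix.specialOrthogonalGroup m ℝ => (O : Matrix m m ℝ) *ᵥ e) =
      (uniformSphere (volume : Measure (EuclideanSpace ℝ m))).map (fun s : sphere (0 : (EuclideanSpace ℝ m)) 1 => ofLp (s : (EuclideanSpace ℝ m))) := by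
  have hes : (toLp 2 e : (EuclideanSpace ℝ m)) ∈ sphere (0 : (EuclideanSpace ℝ m)) 1 := by
    rw [mem_sphere_zero_iff_norm]
    have h := norm_toLp_sq (m := m) e
    rw [he] at h
    exact (pow_left_inj₀ (norm_nonneg _) zero_le_one two_ne_zero).1 (h.trans (one_pow 2).symm)
  set es : sphere (0 : (EuclideanSpace ℝ m)) 1 := ⟨toLp 2 e, hes⟩
  have hcoe : Measurable fun s : sphere (0 : (EuclideanSpace ℝ m)) 1 => ofLp (s : (EuclideanSpace ℝ m)) :=
    (measurable_ofLp 2 _).comp measurable_subtype_coe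
  have hfun : (fun O : Matrix.specialOrthogonalGroup m ℝ => (O : Matrix m m ℝ) *ᵥ e) =
      (fun s : sphere (0 : (EuclideanSpace ℝ m)) 1 => ofLp (s : (EuclideanSpace ℝ m))) ∘ (fun O => actSO O es) := by
    funext O
    simp [es]
  rw [hfun, ← Measure.map_map hcoe (measurable_actSO_left es), ← orbitLaw, orbitLaw_eq_uniformSphere h2 es]

end Orbit

end Summit.Ventures.LatticeQCDFlow.Exactness
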